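import Literature.Computability.Complexity.MurrayWilliams2018Lemma13
import HarnessLib

/-!
# Superpolynomial polynomial-time-computable bounds are time constructible, with all their powers

Literature / complexity toolkit, serving the discharge of the simulation hypotheses of
Murray–Williams' Theorem 1.2 (`MurrayWilliams2018Hierarchy.lean`,
`MurrayWilliams2018LevelSimulation.lean`; C. D. Murray, R. R. Williams, STOC 2018, §5). There the
time bound `g` of the hard language is abstract: polynomial-time computable from `1ⁿ` to binary
(`PolyTimeComputable unaryEncodeNat encodeNat g`), `g n ≥ n`, and of superpolynomial growth in
the logarithmic form `∀ c, ∀ᶠ n, c · (log₂ n)^P ≤ log₂ (g n)` (`P = kKr ≥ 1`). The simulation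
lays out verifiers of the level `gᵇ` and transports verifiers between such levels along unary
clocks (`NVerifier.exists_transport`, `HasWitnessCircuits.of_timeConstructible`), which needs
these levels to be time constructible in the tree's sense (`IsTimeConstructible`, `Classes.lean`:
`t n ≥ n` and `1ⁿ ↦ bin (t n)` in time `O(t n)`). This file proves it once:

* `eventually_pow_le_of_log_growth`, `exists_poly_le_of_log_growth` — under
  `∀ c, ∀ᶠ n, c · log₂ n ≤ log₂ (g n)` every power, hence every polynomial, is `O(g)`
  (`p(n) ≤ C · g(n) + C` for all `n`);
* `log_growth_of_pow` — the logarithmic growth hypothesis with an exponent `P ≥ 1` implies the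
  one with `P = 1`;
* `polyTimeComputable_pow` — `n ↦ g(n)ᵇ` is polynomial-time computable from `1ⁿ` when `g` is
  (composition with the `FP` brick `natPowFn`, `PolyTimeComputable.comp_holds`);
* **`isTimeConstructible_of_log_growth`**, **`isTimeConstructible_pow_of_log_growth`**,
  **`isTimeConstructible_pow_of_log_pow_growth`** — such a `g`, and every power `gᵇ` (`b ≥ 1`),
  is time constructible (Arora–Barak 2009, §1.3: a function `T(n) ≥ n` computable from `1ⁿ` in
  time `O(T(n))` is time constructible; the polynomial running time is `O(g)`), whence unary
  clocks `x ↦ ⟨x, 1^{g(|x|)ᵇ}⟩` in time `O(gᵇ)` (`exists_unaryClock_pow_of_log_pow_growth`, by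
  `exists_unaryClock_of_timeConstructible`, `NTIMEHierarchyClock.lean`).

No notion, definition or named fact is introduced (theorems only).

## References

* S. Arora, B. Barak, *Computational Complexity: A Modern Approach*, CUP 2009, §1.3
  (time-constructible functions), Claim 1.6 (composition of polynomial-time machines)
  [AroraBarak2009].
* C. D. Murray, R. R. Williams, *Circuit lower bounds for nondeterministic quasi-polytime: an
  easy witness lemma for NP and NQP*, STOC 2018, §5 (the level `t(n) = 2^{log^a n}`)
  [MurrayWilliams2018].
-/

namespace Literature.Computability.Complexity

open _root_.Computability Turing Filter Asymptotics Polynomial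

/-! ### Logarithmic growth dominates polynomials -/

/-- **Powers are eventually below a bound of superpolynomial logarithmic growth**: if for every
`c` eventually `c · log₂ n ≤ log₂ (g n)`, then for every `d` eventually `nᵈ ≤ g n`
(`nᵈ < 2^{(log₂ n + 1) d} ≤ 2^{(2d+1) log₂ n} ≤ 2^{log₂ (g n)} ≤ g n` for `n ≥ 2`). [folklore] -/
theorem eventually_pow_le_of_log_growth {g : ℕ → ℕ}
    (hlog : ∀ c : ℕ, ∀ᶠ n in atTop, c * Nat.log 2 n ≤ Nat.log 2 (g n)) (d : ℕ) :
    ∀ᶠ n in atTop, n ^ d ≤ g n := by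
  filter_upwards [hlog (2 * d + 1), eventually_ge_atTop 2] with n h hn
  set L := Nat.log 2 n with hL
  have hL1 : 1 ≤ L := Nat.log_pos one_lt_two hn
  have hlt : n < 2 ^ (L + 1) := Nat.lt_pow_succ_log_self one_lt_two n
  have hg0 : g n ≠ 0 := by
    intro h0
    rw [h0, Nat.log_zero_right] at h
    nlinarith
  have h1 : (L + 1) * d ≤ (2 * d + 1) * L := by nlinarith
  calc n ^ d ≤ (2 ^ (L + 1)) ^ d := Nat.pow_le_pow_left hlt.le d
    _ = 2 ^ ((L + 1) * d) := by rw [← pow_mul]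
    _ ≤ 2 ^ ((2 * d + 1) * L) := Nat.pow_le_pow_right two_pos h1
    _ ≤ 2 ^ Nat.log 2 (g n) := Nat.pow_le_pow_right two_pos h
    _ ≤ g n := Nat.pow_log_le_self 2 hg0

/-- **Polynomials are `O(g)` for a bound of superpolynomial logarithmic growth**: for every
polynomial `p` there is `C` with `p(n) ≤ C · g(n) + C` for all `n` (the finitely many small `n`
are absorbed by the additive constant, `exists_add_of_eventually_le`). [folklore] -/
theorem exists_poly_le_of_log_growth {g : ℕ → ℕ}
    (hlog : ∀ c : ℕ, ∀ᶠ n in atTop, c * Nat.log 2 n ≤ Nat.log 2 (g n)) (p : Polynomial ℕ) :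
    ∃ C : ℕ, ∀ n : ℕ, p.eval n ≤ C * g n + C := by
  obtain ⟨c, k, hck⟩ := exists_eval_le_mul_pow_add p
  obtain ⟨A, hA⟩ := exists_add_of_eventually_le (eventually_pow_le_of_log_growth hlog k)
  refine ⟨c * A + c, fun n => (hck n).trans ?_⟩
  calc c * n ^ k + c ≤ c * (g n + A) + c := by gcongr; exact hA n
    _ = c * g n + (c * A + c) := by ring
    _ ≤ (c * A + c) * g n + (c * A + c) :=
        Nat.add_le_add_right (Nat.mul_le_mul_right _ (by omega)) _

/-- The logarithmic growth hypothesis with an exponent `P ≥ 1` (the form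
`∀ c, ∀ᶠ n, c · (log₂ n)^P ≤ log₂ (g n)` of the simulation hypotheses of
`MurrayWilliams2018Hierarchy.lean` / `MurrayWilliams2018LevelSimulation.lean`, `P = kKr`) implies
the one with exponent `1`. [folklore] -/
theorem log_growth_of_pow {g : ℕ → ℕ} {P : ℕ} (hP : 1 ≤ P)
    (h : ∀ c : ℕ, ∀ᶠ n in atTop, c * Nat.log 2 n ^ P ≤ Nat.log 2 (g n)) :
    ∀ c : ℕ, ∀ᶠ n in atTop, c * Nat.log 2 n ≤ Nat.log 2 (g n) := by
  intro c
  refine (h c).mono fun n hn => le_trans (Nat.mul_le_mul_left c ?_) hn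
  rcases Nat.eq_zero_or_pos (Nat.log 2 n) with h0 | hpos
  · rw [h0]; exact Nat.zero_le _
  · calc Nat.log 2 n = Nat.log 2 n ^ 1 := (pow_one _).symm
      _ ≤ Nat.log 2 n ^ P := Nat.pow_le_pow_right hpos hP

/-! ### Powers of a polynomial-time computable bound -/

/-- **`n ↦ g(n)ᵇ` is polynomial-time computable from `1ⁿ` (binary output) when `g` is**: compose
the machine of `g` with the `FP` brick `natPowFn b : bin m ↦ bin (mᵇ)` (`SmoothQuasiPoly.lean`)
by `PolyTimeComputable.comp_holds` (Arora–Barak 2009, Claim 1.6).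
[cite: AroraBarak2009, Claim 1.6 and §1.3] -/
theorem polyTimeComputable_pow {g : ℕ → ℕ} (hg : PolyTimeComputable unaryEncodeNat encodeNat g)
    (b : ℕ) : PolyTimeComputable unaryEncodeNat encodeNat fun n => g n ^ b := by
  have hpow : PolyTimeComputable encodeNat encodeNat fun m : ℕ => m ^ b :=
    PolyTimeComputable.of_encode (Brick.natPowFn_mem_FP b) encodeNat (fun _ => rfl) fun m => by
      simp only [Brick.natPowFn_apply, bitsToNat_encodeNat, id]
  have h := PolyTimeComputable.comp_holds hpow hg
  exact h

/-! ### Time constructibility -/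

/-- **A polynomial-time computable bound `g ≥ id` of superpolynomial logarithmic growth is time
constructible** (Arora–Barak 2009, §1.3: computable from `1ⁿ` in time `O(g(n))`, here because the
polynomial running time is `O(g)`, `exists_poly_le_of_log_growth`;
`isTimeConstructible_of_polyTimeComputable`, `MurrayWilliams2018Lemma13.lean`).
[cite: AroraBarak2009, §1.3] -/
theorem isTimeConstructible_of_log_growth {g : ℕ → ℕ}
    (hg : PolyTimeComputable unaryEncodeNat encodeNat g) (hge : ∀ n, n ≤ g n)
    (hlog : ∀ c : ℕ, ∀ᶠ n in atTop, c * Nat.log 2 n ≤ Nat.log 2 (g n)) :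
    IsTimeConstructible g :=
  isTimeConstructible_of_polyTimeComputable hg (exists_poly_le_of_log_growth hlog) hge

/-- **Every power `gᵇ`, `b ≥ 1`, of such a bound is time constructible** (`polyTimeComputable_pow`;
every polynomial is `O(g) ⊆ O(gᵇ)`). [cite: AroraBarak2009, §1.3] -/
theorem isTimeConstructible_pow_of_log_growth {g : ℕ → ℕ}
    (hg : PolyTimeComputable unaryEncodeNat encodeNat g) (hge : ∀ n, n ≤ g n)
    (hlog : ∀ c : ℕ, ∀ᶠ n in atTop, c * Nat.log 2 n ≤ Nat.log 2 (g n)) {b : ℕ} (hb : 1 ≤ b) :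
    IsTimeConstructible fun n => g n ^ b := by
  have hle : ∀ n, g n ≤ g n ^ b := fun n => Nat.le_self_pow (by omega) (g n)
  refine isTimeConstructible_of_polyTimeComputable (polyTimeComputable_pow hg b) (fun p => ?_)
    fun n => (hge n).trans (hle n)
  obtain ⟨C, hC⟩ := exists_poly_le_of_log_growth hlog p
  exact ⟨C, fun n => (hC n).trans (Nat.add_le_add_right (Nat.mul_le_mul_left C (hle n)) C)⟩

/-- The same under the logarithmic growth hypothesis with an exponent `P ≥ 1` — the form in
which the simulation hypotheses of `MurrayWilliams2018Hierarchy.lean` and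
`MurrayWilliams2018LevelSimulation.lean` state the growth of `g` (`P = kKr`).
[cite: AroraBarak2009, §1.3] -/
theorem isTimeConstructible_pow_of_log_pow_growth {g : ℕ → ℕ}
    (hg : PolyTimeComputable unaryEncodeNat encodeNat g) (hge : ∀ n, n ≤ g n) {P : ℕ} (hP : 1 ≤ P)
    (hlog : ∀ c : ℕ, ∀ᶠ n in atTop, c * Nat.log 2 n ^ P ≤ Nat.log 2 (g n)) {b : ℕ} (hb : 1 ≤ b) :
    IsTimeConstructible fun n => g n ^ b :=
  isTimeConstructible_pow_of_log_growth hg hge (log_growth_of_pow hP hlog) hb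

/-- **Unary clocks for the levels `gᵇ`**: under the same hypotheses some `TM2` machine maps every
`x` to `⟨x, 1^{g(|x|)ᵇ}⟩` within `a · g(|x|)ᵇ + a` steps (`exists_unaryClock_of_timeConstructible`,
`NTIMEHierarchyClock.lean`) — the clock along which `gᵇ`-verifiers are transported
(`NVerifier.exists_transport`, `HasWitnessCircuits.of_clocks`). [cite: AroraBarak2009, §1.3] -/
theorem exists_unaryClock_pow_of_log_pow_growth {g : ℕ → ℕ}
    (hg : PolyTimeComputable unaryEncodeNat encodeNat g) (hge : ∀ n, n ≤ g n) {P : ℕ} (hP : 1 ≤ P)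
    (hlog : ∀ c : ℕ, ∀ᶠ n in atTop, c * Nat.log 2 n ^ P ≤ Nat.log 2 (g n)) {b : ℕ} (hb : 1 ≤ b) :
    ∃ (N : TM2ComputableAux Bool Bool) (a : ℕ), ∀ x : List Bool,
      N.OutputsWithin x (boolPair x (List.replicate (g x.length ^ b) true))
        (a * g x.length ^ b + a) :=
  exists_unaryClock_of_timeConstructible (isTimeConstructible_pow_of_log_pow_growth hg hge hP hlog hb)

end Literature.Computability.Complexity
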